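import Summits.BirchSwinnertonDyer.Rank1Residual.Additive.XMultRankZeroCyclotomicThreeFacts
import Summits.BirchSwinnertonDyer.Rank1Residual.Additive.XMultRankZeroCyclotomicThreeNoLocal
import HarnessLib

/-!
# Line V15 at Facts level (X3 / X4 (M) at `p = 3` over `K = ℚ(ζ₃)`, ranks `(0,0)`, multiplicative twist: Wuthrich Thm. 16 / Kato + Greenberg from named facts) — Milne's A73 PROVED AWAY
# (cell `b2b-bsdres`, team n1011, seat p16 GEN 11; lead R5-87 (e) (W2) = additive-p4 GEN 23 word: the
# UPPER / two-sided no-Milne twins of the additive-p4 ℚ(ζ₃) lines are the p16 lineage's; row T-MIL-CAN)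

HONEST FRAMING (cell `b2b-bsdres`, run/shared/lean/b2b/bsd-rank1-residual/, verbatim in every
file): the goal of the cell is to DELETE the COMBINATION-SHAPED residual classes of the
Birch–Swinnerton-Dyer formula for ALL analytic-rank `≤ 1` elliptic curves over `ℚ` — "full BSD
formula for every rank `≤ 1` curve in class `C`" assembled STRICTLY from published theorems — so
that the rank-`≤ 1` remainder becomes exactly the CONSTRUCTION-SHAPED classes, which are TYPED
(missing-input `Prop`s), NOT attempted. This is not "finishing BSD". Team n1011 (N10 / N11), seat p16:
research route; X1 / X3 / X4 / X10 / N10 / N11 labels and marks UNCHANGED; nothing booked. Theorems only.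

This file is `XMultRankZeroCyclotomicThreeFacts.lean` (mathematics, census and references in THAT file's docstrings,
unchanged) with the Milne binder `hMilne : Milne1972.bsdQuotient_baseChange_quadratic_anyModel` (A73)
DELETED from every Milne-binding theorem and NOTHING added: each such theorem is re-issued under its name
with the suffix `_noMilne`, every other binder and every proof line byte-identical, every call to a
Milne-binding tree theorem redirected to its no-Milne twin (`…_noLocal` cores / `…_noMilne` Facts of the
p16 lineage); Milne-free helpers of the source file are used as landed, not re-declared. What the
additive-p4 cores read from A73 — `Ш(V_K)` finite and the `3`-adic valuation of the card identity over
`K = ℚ(ζ₃)` — are the THEOREMS `shaFinite_baseChange_of_twist` and T-MIL-CAN FILE 4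
`padicVal_card_identity_baseChange[_anyRank]_of_natAbs_discr_eq` (`|d_K| = 3`, `V` good or multiplicative
at `3`: the per-place fibre identities (T) at EVERY place — n1011-p01's T-MIL-3 H-5a with rows T-MIL-B2 /
T-A233 inside). Every other displayed hypothesis (named facts, (⊇/K) where present, census bits,
certificates) is exactly the source file's. Labels UNCHANGED; nothing booked; no mark moves.
-/

noncomputable section

open scoped Classical MatrixGroups ModularForm

open CongruenceSubgroup WeierstrassCurve NumberField IsDedekindDomain
  Literature.NumberTheory.EllipticCurves Literature.NumberTheory.EllipticCurves.ModularForms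
  Literature.NumberTheory.EllipticCurves.Rank1Residual
  Literature.NumberTheory.EllipticCurves.Rank1Residual.Typed
  Literature.NumberTheory.GaloisRepresentations

namespace Summit.BirchSwinnertonDyer.Rank1Residual.Additive

/-! ## §1 `hGrK` from Greenberg's multiplicative analogue of Theorem 4.1 -/

section GreenbergK

variable (K : Type) [Field K] [NumberField K] [IsCyclotomicExtension {3} ℚ K]
  (V : WeierstrassCurve ℚ) [V.IsElliptic] [V.IsGloballyMinimal]

end GreenbergK

/-! ## §2 The two tame branches at `T = 0` at a non-split multiplicative prime -/

section ConstantTerms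

variable (p : ℕ) [hp : Fact p.Prime]

end ConstantTerms

/-! ## §3 X3: `V[3]` reducible — Wuthrich Thm. 16 at the non-split multiplicative prime, over `ℚ(ζ₃)` -/

section X3Facts

variable (V : WeierstrassCurve ℚ) [V.IsElliptic] [V.IsGloballyMinimal]
  (W : WeierstrassCurve ℚ) [W.IsElliptic] [W.IsGloballyMinimal]

/-- **Line V15 (X3 (M)-rows, `p = 3`), core inequality, from named facts only.** Let `V/ℚ` be
globally minimal with NON-SPLIT multiplicative reduction at `3` and `V[3]` REDUCIBLE, and
`W = C • V^{(−3)}` a globally minimal model of its twist by `−3`, ADDITIVE at `3` (the X3 ∧ (M)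
situation at `p = 3`, Kodaira `I_n*`), both of analytic rank `0`. Then `#Ш_an(V) = q_V`,
`#Ш_an(W) = q_W` are rationals with **`ord₃ #Ш(V) + ord₃ #Ш(W) ≤ ord₃ q_V + ord₃ q_W`**, granted
EXACTLY: Wuthrich 2014 Thm. 16 (non-split multiplicative `3`, over `ℚ(ζ₃)`; named fact `hW16`),
Greenberg LNM 1716 pp. 112–113 (named fact `hGr`), modularity (`hmod`,
`hmodD`), Gross–Zagier–Kolyvagin (`hGZK`). `K` is instantiated as `CyclotomicField 3 ℚ`; the newform,
the period ratios `ϖ, ϖ'`, the even branch (`exists_isMultPAdicLFunctionOf_neg_one_of_nonsplit`) and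
both constant terms are THEOREMS. [cite: Wuthrich2014, Thm. 16 (p. 397)] [cite: GreenbergLNM1716, §4 pp. 112–113]
[cite: Milne1972ArithmeticAV, §1 Thm. 1 and §2 (through DokchitserDokchitserAnnals2010, §2.1, proof of Thm. 8)] -/
theorem XMultCyclotomicThree.exists_padicVal_shaOrder_add_le_of_facts_of_red_noMilne
    (hW16 : Wuthrich2014.thm16_charIdeal_dvd_nonsplitMultiplicative_cyclotomicThree)
    (hGr : Greenberg1999.thm41Analogue_charValue_rankZero_numberField)
    (hGZK : rank_eq_analyticRank_of_analyticRank_le_one) (hmod : hasEntireLFunction_rat)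
    (hmodD : nonempty_modularParametrizationData)
    (C : VariableChange ℚ) (hC : C • V.quadraticTwist (-(3 : ℚ)) = W)
    (hmult : V.HasMultiplicativeReductionAtPrime 3) (hns : ¬ V.HasSplitMultiplicativeReductionAtPrime 3)
    (hred : ¬ V.HasIrreducibleModPGaloisRep 3) (hadd : Addv W 3)
    (hrV : V.analyticRank = 0) (hrW : W.analyticRank = 0) :
    ∃ qV qW : ℚ, shaAn V = (qV : ℂ) ∧ shaAn W = (qW : ℂ) ∧
      (padicValNat 3 V.shaOrder : ℤ) + padicValNat 3 W.shaOrder ≤ padicValRat 3 qV + padicValRat 3 qW := by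
  haveI : IsCyclotomicExtension {3} ℚ (CyclotomicField 3 ℚ) := CyclotomicField.isCyclotomicExtension 3 ℚ
  set K := CyclotomicField 3 ℚ
  -- the newform and the two rational period ratios
  haveI : NeZero (V.conductorNorm ℤ) := ⟨(V.conductorNorm_pos_holds).ne'⟩
  obtain ⟨Dm⟩ := hmodD V
  have hf : IsNewformOf V Dm.f := Dm.isNewformOf
  obtain ⟨ϖ, -, hϖ, -⟩ := Dm.exists_rat_mul_realPeriodRat_eq_plusPeriod
  obtain ⟨ϖ', -, hϖ'⟩ := exists_rat_mul_imaginaryPeriodRat_eq_minusPeriod Dm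
  -- the even branch and the two constant terms
  obtain ⟨Lp, hLp⟩ := exists_isMultPAdicLFunctionOf_neg_one_of_nonsplit hf hmult hns
  obtain ⟨ep, -, hLp0⟩ := exists_unit_constantCoeff_of_isMultPAdicLFunctionOf_neg_one hLp
  have hLm0 := constantCoeff_padicLFunctionMinusBranchMult_one_three_of_nonsplit V hmult hns hf
  refine XMultCyclotomicThree.exists_padicVal_shaOrder_add_le_noLocal K V W hGZK hmod C hC hmult hadd hrV
    hrW hf ϖ ϖ' hϖ hϖ' Lp (padicLFunctionMinusBranchMult Dm.f (-1 : ℚ_[3]) 1) ep (-1) hLp0 hLm0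
    (fun κ γ hκ hγ hγ' D ↦ ?_) (XMultCyclotomicThree.greenbergK_of_fact K V hGr hmult hns)
  exact hW16 V K (V.baseChange K) hmult hns hred ⟨1, one_smul _ _⟩ hκ hγ hγ' hf D ϖ ϖ' hϖ hϖ' Lp hLp

/-- **The cell's typed UPPER half for the additive X3 (M)-curve, from named facts only**: in the
situation of `…_of_facts_of_red`, if `#Ш_an(V)` has non-positive `3`-adic valuation (census bit
`3 ∤ #Ш_an(V)` of the twist pair) then `ord₃ #Ш(W) ≤ ord₃ #Ш_an(W)`, i.e. `Typed.MissingUpperBoundAt W 3`.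
[cite: Wuthrich2014, Thm. 16 (p. 397)] [cite: GreenbergLNM1716, §4 pp. 112–113] -/
theorem XMultCyclotomicThree.missingUpperBoundAt_of_facts_of_red_noMilne
    (hW16 : Wuthrich2014.thm16_charIdeal_dvd_nonsplitMultiplicative_cyclotomicThree)
    (hGr : Greenberg1999.thm41Analogue_charValue_rankZero_numberField)
    (hGZK : rank_eq_analyticRank_of_analyticRank_le_one) (hmod : hasEntireLFunction_rat)
    (hmodD : nonempty_modularParametrizationData)
    (C : VariableChange ℚ) (hC : C • V.quadraticTwist (-(3 : ℚ)) = W)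
    (hmult : V.HasMultiplicativeReductionAtPrime 3) (hns : ¬ V.HasSplitMultiplicativeReductionAtPrime 3)
    (hred : ¬ V.HasIrreducibleModPGaloisRep 3) (hadd : Addv W 3)
    (hrV : V.analyticRank = 0) (hrW : W.analyticRank = 0)
    {qV : ℚ} (hqV : shaAn V = (qV : ℂ)) (hv : padicValRat 3 qV ≤ 0) :
    MissingUpperBoundAt W 3 := by
  obtain ⟨qV', qW, hqV', hqW, hle⟩ := XMultCyclotomicThree.exists_padicVal_shaOrder_add_le_of_facts_of_red_noMilne
    V W hW16 hGr hGZK hmod hmodD C hC hmult hns hred hadd hrV hrW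
  have hqq : qV' = qV := by exact_mod_cast hqV'.symm.trans hqV
  subst hqq
  refine ⟨qW, hqW, ?_⟩
  have h0 : (0 : ℤ) ≤ padicValNat 3 V.shaOrder := by positivity
  linarith

/-- **`BSD(W,3) ∧ BSD(V,3)` on the doubly-unit X3 (M)-rows, from named facts only**: in the situation
of `…_of_facts_of_red`, if `#Ш_an(V)` and `#Ш_an(W)` are `3`-adic units then Miller's `BSD(W,3)` and
`BSD(V,3)` hold — for the ADDITIVE X3 pair `(W,3)` (type `I_n*`, `W[3]` reducible, `v₃(j) < 0`) and its
non-split multiplicative Eisenstein twist pair `(V,3)` (an X2-type pair) simultaneously. Census (engine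
A, `N < 2·10⁴`): 19 of the 20 CORE-open rank-`(0,0)` X3 ∧ (M) ∧ non-split rows at `p = 3` are
doubly-unit. Labels UNCHANGED; nothing booked by this theorem.
[cite: Wuthrich2014, Thm. 16 (p. 397)] [cite: GreenbergLNM1716, §4 pp. 112–113]
[cite: Milne1972ArithmeticAV, §1 Thm. 1 and §2 (through DokchitserDokchitserAnnals2010, §2.1, proof of Thm. 8)] -/
theorem XMultCyclotomicThree.bsdp_of_shaAn_units_of_facts_of_red_noMilne
    (hW16 : Wuthrich2014.thm16_charIdeal_dvd_nonsplitMultiplicative_cyclotomicThree)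
    (hGr : Greenberg1999.thm41Analogue_charValue_rankZero_numberField)
    (hGZK : rank_eq_analyticRank_of_analyticRank_le_one) (hmod : hasEntireLFunction_rat)
    (hmodD : nonempty_modularParametrizationData)
    (C : VariableChange ℚ) (hC : C • V.quadraticTwist (-(3 : ℚ)) = W)
    (hmult : V.HasMultiplicativeReductionAtPrime 3) (hns : ¬ V.HasSplitMultiplicativeReductionAtPrime 3)
    (hred : ¬ V.HasIrreducibleModPGaloisRep 3) (hadd : Addv W 3)
    (hrV : V.analyticRank = 0) (hrW : W.analyticRank = 0)
    {qV qW : ℚ} (hqV : shaAn V = (qV : ℂ)) (hqW : shaAn W = (qW : ℂ))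
    (hvV : padicValRat 3 qV = 0) (hvW : padicValRat 3 qW = 0) : BSDp W 3 ∧ BSDp V 3 := by
  obtain ⟨qV', qW', hqV', hqW', hle⟩ :=
    XMultCyclotomicThree.exists_padicVal_shaOrder_add_le_of_facts_of_red_noMilne V W hW16 hGr hGZK hmod
      hmodD C hC hmult hns hred hadd hrV hrW
  have hqq : qV' = qV := by exact_mod_cast hqV'.symm.trans hqV
  have hqq' : qW' = qW := by exact_mod_cast hqW'.symm.trans hqW
  subst hqq hqq'
  rw [hvV, hvW, add_zero] at hle
  have hV0 : (0 : ℤ) ≤ padicValNat 3 V.shaOrder := by positivity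
  have hW0 : (0 : ℤ) ≤ padicValNat 3 W.shaOrder := by positivity
  have huW : MissingUpperBoundAt W 3 := ⟨qW', hqW', by rw [hvW]; linarith⟩
  have huV : MissingUpperBoundAt V 3 := ⟨qV', hqV', by rw [hvV]; linarith⟩
  exact ⟨bsdp_of_missingPPartAt W 3 hGZK (by rw [hrW]; exact zero_le_one)
      (missingPPartAt_of_upper_of_shaAn_unit W 3 huW hqW' hvW),
    bsdp_of_missingPPartAt V 3 hGZK (by rw [hrV]; exact zero_le_one)
      (missingPPartAt_of_upper_of_shaAn_unit V 3 huV hqV' hvV)⟩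

/-- **The `3 ∣ #Ш_an(W)` rows (X3 ∧ (M) ∧ non-split): `BSD(W,3)` from ONE finite certificate, named
facts otherwise.** If `#Ш_an(V)` is a `3`-adic unit, `#Ш_an(W) = q` with `ord₃ q ≤ 2k` and
`3^{2k−1} ∣ #Ш(W)` (for `k = 1`: `Ш(W)[3] ≠ 0`, a `3`-descent certificate), then `BSD(W,3)` (upper half
above + Cassels–Tate squareness `hCT`). Census: the only such rank-`(0,0)` row is 15138i1 (`V` = 5046i1).
[cite: Wuthrich2014, Thm. 16 (p. 397)] [cite: SilvermanAEC2009, Thm. X.4.14] [cite: Miller2011LMS, §1 and Def. 1.1] -/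
theorem XMultCyclotomicThree.bsdp_of_casselsTate_of_pow_dvd_of_facts_of_red_noMilne
    (hW16 : Wuthrich2014.thm16_charIdeal_dvd_nonsplitMultiplicative_cyclotomicThree)
    (hGr : Greenberg1999.thm41Analogue_charValue_rankZero_numberField)
    (hGZK : rank_eq_analyticRank_of_analyticRank_le_one) (hmod : hasEntireLFunction_rat)
    (hmodD : nonempty_modularParametrizationData) (hCT : exists_casselsTate_pairing (K := ℚ))
    (C : VariableChange ℚ) (hC : C • V.quadraticTwist (-(3 : ℚ)) = W)
    (hmult : V.HasMultiplicativeReductionAtPrime 3) (hns : ¬ V.HasSplitMultiplicativeReductionAtPrime 3)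
    (hred : ¬ V.HasIrreducibleModPGaloisRep 3) (hadd : Addv W 3)
    (hrV : V.analyticRank = 0) (hrW : W.analyticRank = 0)
    {qV : ℚ} (hqV : shaAn V = (qV : ℂ)) (hvV : padicValRat 3 qV ≤ 0)
    {q : ℚ} (hq : shaAn W = (q : ℂ)) {k : ℕ} (hv : padicValRat 3 q ≤ 2 * k)
    (hdvd : 3 ^ (2 * k - 1) ∣ W.shaOrder) : BSDp W 3 :=
  bsdp_of_missingPPartAt W 3 hGZK (by rw [hrW]; exact zero_le_one)
    (missingPPartAt_of_lower_of_upper W 3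
      (missingLowerBoundAt_of_casselsTate_of_pow_dvd W 3 hCT (hGZK W (by rw [hrW]; exact zero_le_one)).2
        hq hv hdvd)
      (XMultCyclotomicThree.missingUpperBoundAt_of_facts_of_red_noMilne V W hW16 hGr hGZK hmod hmodD C hC
        hmult hns hred hadd hrV hrW hqV hvV))

end X3Facts

end Summit.BirchSwinnertonDyer.Rank1Residual.Additive

end
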